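import Mathlib
import HarnessLib
import Literature.Probability.Process.PointStationaryLaw
import Literature.MathematicalPhysics.StatisticalMechanics.MuGroundStateConfiguration
import Summits.AtomisticToContinuum.Crystallization.Theorems.FrustratedLawDichotomyNashLocalStability

/-!
# Crux `AperiodicFrustratedLawGap` — what the NASH clause (e) gives pointwise: FORCE BALANCE at every atom

Route `FrustratedLawDichotomy` (and `PeriodicChargeSplit`), crux `AperiodicFrustratedLawGap`
(item `stmt-AtomisticToContinuum-27623`); hand-1 lane (direct consequences of the crux's own hypotheses), companion of
`FrustratedLawDichotomyHardCoreUpgrade` (clause (d) ⟹ a.s. `7/10` hard core).  This module is ROUTE-INDEPENDENT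
(no `Theses` import, directly or transitively): it consumes clauses (a) and (e) of the crux in their inlined form.
(Re-based on `Literature…MuGroundStateConfiguration` — the `UniformlyDiscrete` variant importable next to the route file —
so that by-name cuts of the crux can import it; statements unchanged.)

Clause (e) of the crux says that `P`-almost every configuration `μ` is NASH: for every atom `p` and every position
`y` off the other atoms, `Σ'_{q ≠ p} V_LJ(|p − q|) ≤ Σ'_{q ≠ p} V_LJ(|y − q|)` (sums over the atoms `q ≠ p` of `μ`).
For a hard-core configuration (clause (a), any `δ > 0`) the one-particle field `F(w) = Σ'_{q ≠ p} V_LJ(|w − q|)` is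
Fréchet-differentiable on the ball `B(p, δ/2)` (termwise: `hasFDerivAt_tsum_of_isPreconnected`, `r⁻⁷` decay of
`V_LJ′`, shell counting `FrustratedLawDichotomyNashLocalStability.summable_inv_pow_six_of_sep`), every `w` in that ball is off the other
atoms, so Nash makes `p` a local minimum of `F` and Fermat (`IsLocalMin.hasFDerivAt_eq_zero`) kills the gradient:

* `hasSum_force_of_nash` — **force balance**: `Σ_{q ≠ p} (|p − q|⁻⁸ − |p − q|⁻¹⁴)·(p − q) = 0` (`HasSum`, absolutely
  convergent), i.e. `Σ_{q ≠ p} V_LJ′(|p − q|)·(p − q)/|p − q| = 0` since `V_LJ′(r) = −r⁻¹³ + r⁻⁷`;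
* `ae_forceBalance_of_nash` — law level: under clauses (a) (any nominal `δ > 0`) and (e) of the crux, `P`-almost every
  configuration is a Lennard-Jones EQUILIBRIUM configuration (force balance at EVERY atom).

So a counterexample to the crux is an aperiodic textured point-stationary law carried by `7/10`-hard-core
EQUILIBRIUM configurations (pointwise first-order condition; hand-2's zero Palm stress / virial are the law-level
first-order conditions).  The calculus template is the tree's `tube_muGSC_forceBalance`
(`PalmUnimodularRigidityLayeredLawsSelectHcpForceBalance`, for Sütő `μ`-ground-state configurations); here the
hypothesis is the weaker one-particle Nash test of the crux, verbatim.  All `[folklore]` (Fermat's rule for the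
one-particle field; cf. Blanc–Lewin 2015 §1.2 for finite ground states).
-/

noncomputable section

open Metric Filter Topology MeasureTheory
open scoped RealInnerProductSpace

namespace Summit.AtomisticToContinuum.Crystallization.Theorems.FrustratedLawDichotomyNashForceBalance

open Literature.MathematicalPhysics.StatisticalMechanics (lennardJones UniformlyDiscrete)
open Literature.Probability.Process (IsRootedHardCore count_restrict_singleton_ne_zero_iff)

/-- `D|w − q|(p) = |p − q|⁻¹ ⟨p − q, ·⟩` at `p ≠ q` (in `ℝ³`).
(adapted from the tree's `ExcessDecayLiouvilleForceBalance.hasFDerivAt_dist_left`, stated for `𝔼 d`; restated here to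
keep this module free of route-file imports) [folklore] -/
theorem hasFDerivAt_dist_left_fin3 {p q : EuclideanSpace ℝ (Fin 3)} (hpq : p ≠ q) :
    HasFDerivAt (fun w : EuclideanSpace ℝ (Fin 3) => dist w q) ((dist p q)⁻¹ • innerSL ℝ (p - q)) p := by
  have hne : ‖p - q‖ ≠ 0 := norm_ne_zero_iff.2 (sub_ne_zero.2 hpq)
  have hsq : ‖p - q‖ ^ 2 ≠ 0 := pow_ne_zero 2 hne
  have h1 := ((hasFDerivAt_sub_const (x := p) q).norm_sq).sqrt hsq
  have hfun : (fun w : EuclideanSpace ℝ (Fin 3) => √(‖w - q‖ ^ 2)) = fun w => dist w q :=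
    funext fun w => by rw [Real.sqrt_sq (norm_nonneg _), dist_eq_norm]
  rw [hfun] at h1
  refine h1.congr_fderiv (ContinuousLinearMap.ext fun z => ?_)
  simp [Real.sqrt_sq (norm_nonneg _), dist_eq_norm]
  field_simp

/-- **The gradient of one Lennard-Jones term**: `D[V_LJ(|w − q|)](p) = (|p − q|⁻⁸ − |p − q|⁻¹⁴) ⟨p − q, ·⟩` at
`p ≠ q` (chain rule, `V_LJ′(r)/r = r⁻⁸ − r⁻¹⁴`). [folklore] -/
theorem hasFDerivAt_lennardJones_dist {p q : EuclideanSpace ℝ (Fin 3)} (hpq : p ≠ q) :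
    HasFDerivAt (fun w : EuclideanSpace ℝ (Fin 3) => lennardJones (dist w q))
      (((dist p q)⁻¹ ^ 8 - (dist p q)⁻¹ ^ 14) • innerSL ℝ (p - q)) p := by
  have hne : dist p q ≠ 0 := dist_ne_zero.2 hpq
  -- `V_LJ′(r) = −r⁻¹³ + r⁻⁷` at `r = dist p q ≠ 0` (as in the tree's `PhononStabilityNegative.hasDerivAt_lennardJones`)
  have hV : HasDerivAt lennardJones (-((dist p q)⁻¹) ^ 13 + ((dist p q)⁻¹) ^ 7) (dist p q) := by
    have h1 : HasDerivAt (fun y : ℝ => y⁻¹) (-((dist p q) ^ 2)⁻¹) (dist p q) := hasDerivAt_inv hne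
    have hfun : lennardJones = fun y : ℝ => (1 / 12 : ℝ) * (y⁻¹) ^ 12 - (1 / 6 : ℝ) * (y⁻¹) ^ 6 := by
      funext y; simp [lennardJones]
    rw [hfun]
    refine (((h1.pow 12).const_mul (1 / 12 : ℝ)).sub ((h1.pow 6).const_mul (1 / 6 : ℝ))).congr_deriv ?_
    push_cast
    ring
  have h := hV.comp_hasFDerivAt p (hasFDerivAt_dist_left_fin3 hpq)
  rw [smul_smul] at h
  have hc : (-(dist p q)⁻¹ ^ 13 + (dist p q)⁻¹ ^ 7) * (dist p q)⁻¹ = (dist p q)⁻¹ ^ 8 - (dist p q)⁻¹ ^ 14 := by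
    ring
  rw [hc] at h
  exact h

/-- `|r⁻⁸ − r⁻¹⁴|·r ≤ ((ρ⁻¹)⁷ + ρ⁻¹)·r⁻⁶` for `r ≥ ρ > 0` (the norm of the gradient of one term). [folklore] -/
theorem abs_coeff_mul_le {ρ r : ℝ} (hρ : 0 < ρ) (hr : ρ ≤ r) :
    |r⁻¹ ^ 8 - r⁻¹ ^ 14| * r ≤ ((ρ⁻¹) ^ 7 + ρ⁻¹) * (r⁻¹) ^ 6 := by
  have hr0 : 0 < r := hρ.trans_le hr
  have h0 : 0 ≤ r⁻¹ := inv_nonneg.2 hr0.le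
  have h1 : r⁻¹ ≤ ρ⁻¹ := (inv_le_inv₀ hr0 hρ).2 hr
  have h7 : r⁻¹ ^ 7 ≤ ρ⁻¹ ^ 7 := pow_le_pow_left₀ h0 h1 7
  have h6 : 0 ≤ r⁻¹ ^ 6 := pow_nonneg h0 6
  have e8 : r⁻¹ ^ 8 * r = r⁻¹ ^ 7 := by
    have : r⁻¹ * r = 1 := inv_mul_cancel₀ hr0.ne'
    calc r⁻¹ ^ 8 * r = r⁻¹ ^ 7 * (r⁻¹ * r) := by ring
      _ = r⁻¹ ^ 7 := by rw [this, mul_one]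
  have e14 : r⁻¹ ^ 14 * r = r⁻¹ ^ 13 := by
    have : r⁻¹ * r = 1 := inv_mul_cancel₀ hr0.ne'
    calc r⁻¹ ^ 14 * r = r⁻¹ ^ 13 * (r⁻¹ * r) := by ring
      _ = r⁻¹ ^ 13 := by rw [this, mul_one]
  calc |r⁻¹ ^ 8 - r⁻¹ ^ 14| * r ≤ (|r⁻¹ ^ 8| + |r⁻¹ ^ 14|) * r :=
        mul_le_mul_of_nonneg_right (abs_sub _ _) hr0.le
    _ = r⁻¹ ^ 7 + r⁻¹ ^ 13 := by
        rw [abs_of_nonneg (pow_nonneg h0 8), abs_of_nonneg (pow_nonneg h0 14), add_mul, e8, e14]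
    _ = r⁻¹ * r⁻¹ ^ 6 + r⁻¹ ^ 7 * r⁻¹ ^ 6 := by ring
    _ ≤ ρ⁻¹ * r⁻¹ ^ 6 + ρ⁻¹ ^ 7 * r⁻¹ ^ 6 := by gcongr
    _ = ((ρ⁻¹) ^ 7 + ρ⁻¹) * (r⁻¹) ^ 6 := by ring

/-- **Force balance from the Nash clause (pointwise, deterministic).**  Let `μ = count|S` be a rooted `δ`-hard-core
configuration (`δ > 0`) and `p` an atom of `μ` such that no position `y` off the other atoms lowers the one-particle
field: `Σ'_{q ≠ p} V_LJ(|p − q|) ≤ Σ'_{q ≠ p} V_LJ(|y − q|)` (clause (e) of the crux at `p`, verbatim).  Then the total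
force on `p` vanishes: `Σ_{q ≠ p} (|p − q|⁻⁸ − |p − q|⁻¹⁴)·(p − q) = 0`, the sum converging absolutely (`HasSum`).
Fermat's rule for the termwise-differentiable field on the ball `B(p, δ/2)`, which avoids the other atoms. [folklore] -/
theorem hasSum_force_of_nash {δ : ℝ} (hδ : 0 < δ) {μ : Measure (EuclideanSpace ℝ (Fin 3))}
    (hμ : IsRootedHardCore δ μ) {p : EuclideanSpace ℝ (Fin 3)} (hp : μ {p} ≠ 0)
    (hNash : ∀ y : EuclideanSpace ℝ (Fin 3), (∀ q : EuclideanSpace ℝ (Fin 3), μ {q} ≠ 0 → q ≠ p → y ≠ q) →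
      ∑' q : {q : EuclideanSpace ℝ (Fin 3) // μ {q} ≠ 0 ∧ q ≠ p}, lennardJones (dist p (q : EuclideanSpace ℝ (Fin 3))) ≤
        ∑' q : {q : EuclideanSpace ℝ (Fin 3) // μ {q} ≠ 0 ∧ q ≠ p}, lennardJones (dist y (q : EuclideanSpace ℝ (Fin 3)))) :
    HasSum (fun q : {q : EuclideanSpace ℝ (Fin 3) // μ {q} ≠ 0 ∧ q ≠ p} =>
      ((dist p q)⁻¹ ^ 8 - (dist p q)⁻¹ ^ 14) • (p - (q : EuclideanSpace ℝ (Fin 3)))) 0 := by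
  obtain ⟨S, -, hsep, rfl⟩ := hμ
  have hmem : ∀ q : EuclideanSpace ℝ (Fin 3),
      (Measure.count : Measure (EuclideanSpace ℝ (Fin 3))).restrict S {q} ≠ 0 ↔ q ∈ S :=
    count_restrict_singleton_ne_zero_iff S
  have hpS : p ∈ S := (hmem p).1 hp
  -- the punctured configuration and its index type
  set Y : Set (EuclideanSpace ℝ (Fin 3)) :=
    {q | (Measure.count : Measure (EuclideanSpace ℝ (Fin 3))).restrict S {q} ≠ 0 ∧ q ≠ p} with hY
  have hYS : ∀ q : Y, (q : EuclideanSpace ℝ (Fin 3)) ∈ S := fun q => (hmem q).1 q.2.1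
  have hYud : UniformlyDiscrete Y :=
    ⟨δ, hδ, fun x hx y hy hxy => hsep x ((hmem x).1 hx.1) y ((hmem y).1 hy.1) hxy⟩
  have hfar : ∀ q : Y, δ ≤ dist p q := fun q => hsep p hpS q (hYS q) fun h => q.2.2 (h ▸ rfl)
  -- the one-particle field and its termwise derivative on the ball `B(p, δ/2)`
  set U : Set (EuclideanSpace ℝ (Fin 3)) := ball p (δ / 2) with hU
  have hdistU : ∀ w ∈ U, ∀ q : Y, dist p q / 2 ≤ dist w q ∧ δ / 2 ≤ dist w q := by
    intro w hw q
    have h1 : dist p w < δ / 2 := by rw [dist_comm]; exact mem_ball.1 hw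
    have h2 := hfar q
    have h3 : dist p q ≤ dist p w + dist w q := dist_triangle _ _ _
    constructor <;> linarith
  set C : ℝ := ((δ / 2)⁻¹) ^ 7 + (δ / 2)⁻¹ with hC
  have hC0 : 0 ≤ C := by positivity
  set f : Y → EuclideanSpace ℝ (Fin 3) → ℝ := fun q w => lennardJones (dist w q) with hf
  set f' : Y → EuclideanSpace ℝ (Fin 3) → (EuclideanSpace ℝ (Fin 3) →L[ℝ] ℝ) := fun q w =>
    ((dist w q)⁻¹ ^ 8 - (dist w q)⁻¹ ^ 14) • innerSL ℝ (w - (q : EuclideanSpace ℝ (Fin 3))) with hf'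
  set u : Y → ℝ := fun q => C * 2 ^ 6 * (dist p q)⁻¹ ^ 6 with hu
  have hderiv : ∀ (q : Y) (w : EuclideanSpace ℝ (Fin 3)), w ∈ U → HasFDerivAt (f q) (f' q w) w := by
    intro q w hw
    have hwq : w ≠ (q : EuclideanSpace ℝ (Fin 3)) := by
      intro h
      have := (hdistU w hw q).2
      rw [h, dist_self] at this
      linarith
    exact hasFDerivAt_lennardJones_dist hwq
  have hbound : ∀ (q : Y) (w : EuclideanSpace ℝ (Fin 3)), w ∈ U → ‖f' q w‖ ≤ u q := by
    intro q w hw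
    obtain ⟨hhalf, hρ⟩ := hdistU w hw q
    have hwq0 : 0 < dist w q := by linarith
    have hpq0 : 0 < dist p q := by linarith [hfar q]
    have hn : ‖f' q w‖ = |(dist w q)⁻¹ ^ 8 - (dist w q)⁻¹ ^ 14| * dist w q := by
      simp only [hf']
      rw [norm_smul, innerSL_apply_norm, Real.norm_eq_abs, ← dist_eq_norm]
    rw [hn]
    have h1 := abs_coeff_mul_le (by positivity : (0 : ℝ) < δ / 2) hρ
    have h2 : (dist w q)⁻¹ ^ 6 ≤ 2 ^ 6 * (dist p q)⁻¹ ^ 6 := by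
      have : (dist w q)⁻¹ ≤ 2 * (dist p q)⁻¹ := by
        rw [← inv_inv (2 : ℝ), ← mul_inv, inv_le_inv₀ hwq0 (by positivity)]
        linarith
      calc (dist w q)⁻¹ ^ 6 ≤ (2 * (dist p q)⁻¹) ^ 6 :=
            pow_le_pow_left₀ (inv_nonneg.2 hwq0.le) this 6
        _ = 2 ^ 6 * (dist p q)⁻¹ ^ 6 := by ring
    calc |(dist w q)⁻¹ ^ 8 - (dist w q)⁻¹ ^ 14| * dist w q ≤ C * (dist w q)⁻¹ ^ 6 := h1
      _ ≤ C * (2 ^ 6 * (dist p q)⁻¹ ^ 6) := mul_le_mul_of_nonneg_left h2 hC0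
      _ = u q := by simp only [hu]; ring
  have hu_sum : Summable u :=
    (Summit.AtomisticToContinuum.Crystallization.Theorems.FrustratedLawDichotomyNashLocalStability.summable_inv_pow_six_of_sep
      hδ hsep (fun q hq => (hmem q).1 hq.1) (fun q hq => hfar ⟨q, hq⟩)).mul_left (C * 2 ^ 6)
  have hf0 : Summable fun q : Y => f q p := hYud.summable_lennardJones_dist p
  have hpU : p ∈ U := mem_ball_self (by positivity)
  have hF : HasFDerivAt (fun w => ∑' q : Y, f q w) (∑' q : Y, f' q p) p :=
    hasFDerivAt_tsum_of_isPreconnected hu_sum isOpen_ball (convex_ball p (δ / 2)).isPreconnected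
      hderiv hbound hpU hf0 hpU
  -- the Nash test: `F(p) ≤ F(w)` on the ball (every `w` there is off the other atoms, by the hard core)
  have hmin : IsLocalMin (fun w => ∑' q : Y, f q w) p := by
    have hball : U ∈ 𝓝 p := isOpen_ball.mem_nhds hpU
    refine Filter.eventually_of_mem hball fun w hw => ?_
    have hwoff : ∀ q : EuclideanSpace ℝ (Fin 3),
        (Measure.count : Measure (EuclideanSpace ℝ (Fin 3))).restrict S {q} ≠ 0 → q ≠ p → w ≠ q := by
      intro q hq hqp hwq
      have := (hdistU w hw ⟨q, hq, hqp⟩).2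
      rw [hwq, dist_self] at this
      linarith
    show ∑' q : Y, lennardJones (dist p q) ≤ ∑' q : Y, lennardJones (dist w q)
    exact hNash w hwoff
  -- Fermat: the derivative vanishes
  have hzero : ∑' q : Y, f' q p = 0 := hmin.hasFDerivAt_eq_zero hF
  -- identify the vector sum
  set v : Y → EuclideanSpace ℝ (Fin 3) := fun q =>
    ((dist p q)⁻¹ ^ 8 - (dist p q)⁻¹ ^ 14) • (p - (q : EuclideanSpace ℝ (Fin 3))) with hv
  have hv_norm : ∀ q, ‖v q‖ ≤ u q := by
    intro q
    have h := hbound q p hpU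
    have e1 : ‖v q‖ = |(dist p q)⁻¹ ^ 8 - (dist p q)⁻¹ ^ 14| * dist p q := by
      simp only [hv]
      rw [norm_smul, Real.norm_eq_abs, ← dist_eq_norm]
    have e2 : ‖f' q p‖ = |(dist p q)⁻¹ ^ 8 - (dist p q)⁻¹ ^ 14| * dist p q := by
      simp only [hf']
      rw [norm_smul, innerSL_apply_norm, Real.norm_eq_abs, ← dist_eq_norm]
    rw [e1, ← e2]
    exact h
  have hv_sum : Summable v := Summable.of_norm_bounded hu_sum hv_norm
  have hf'_sum : Summable fun q => f' q p := Summable.of_norm_bounded hu_sum fun q => hbound q p hpU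
  set s : EuclideanSpace ℝ (Fin 3) := ∑' q, v q with hs
  have hinner : ∀ z : EuclideanSpace ℝ (Fin 3), ⟪z, s⟫ = 0 := by
    intro z
    have h1 : HasSum (fun q => ⟪z, v q⟫) ⟪z, s⟫ := (hv_sum.hasSum).mapL (innerSL ℝ z)
    have h2 : HasSum (fun q => f' q p z) ((∑' q : Y, f' q p) z) :=
      (hf'_sum.hasSum).mapL (ContinuousLinearMap.apply ℝ ℝ z)
    rw [hzero] at h2
    simp only [_root_.zero_apply] at h2
    have h3 : (fun q => f' q p z) = fun q => ⟪z, v q⟫ := by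
      funext q
      simp only [hf', hv, _root_.smul_apply, innerSL_apply_apply, smul_eq_mul, inner_smul_right]
      rw [real_inner_comm]
    rw [h3] at h2
    exact h1.unique h2
  have hs0 : s = 0 := inner_self_eq_zero.1 (hinner s)
  have hmain : HasSum v 0 := by rw [← hs0]; exact hv_sum.hasSum
  exact hmain

/-- **Clauses (a) + (e) of the crux ⟹ almost-sure force balance at every atom.**  If `P`-almost every configuration
is rooted `δ`-hard-core (`δ > 0`) and `P`-almost every configuration is Nash (clause (e) of `AperiodicFrustratedLawGap`,
verbatim), then `P`-almost every configuration is a Lennard-Jones EQUILIBRIUM configuration: at every atom `p`,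
`Σ_{q ≠ p} (|p − q|⁻⁸ − |p − q|⁻¹⁴)·(p − q) = 0`. [folklore] -/
theorem ae_forceBalance_of_nash {δ : ℝ} (hδ : 0 < δ) {P : Measure (Measure (EuclideanSpace ℝ (Fin 3)))}
    (ha : ∀ᵐ μ ∂P, IsRootedHardCore δ μ)
    (he : ∀ᵐ μ ∂P, ∀ p : EuclideanSpace ℝ (Fin 3), μ {p} ≠ 0 → ∀ y : EuclideanSpace ℝ (Fin 3),
      (∀ q : EuclideanSpace ℝ (Fin 3), μ {q} ≠ 0 → q ≠ p → y ≠ q) →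
      ∑' q : {q : EuclideanSpace ℝ (Fin 3) // μ {q} ≠ 0 ∧ q ≠ p},
          lennardJones (dist p (q : EuclideanSpace ℝ (Fin 3))) ≤
        ∑' q : {q : EuclideanSpace ℝ (Fin 3) // μ {q} ≠ 0 ∧ q ≠ p},
          lennardJones (dist y (q : EuclideanSpace ℝ (Fin 3)))) :
    ∀ᵐ μ ∂P, ∀ p : EuclideanSpace ℝ (Fin 3), μ {p} ≠ 0 →
      HasSum (fun q : {q : EuclideanSpace ℝ (Fin 3) // μ {q} ≠ 0 ∧ q ≠ p} =>
        ((dist p q)⁻¹ ^ 8 - (dist p q)⁻¹ ^ 14) • (p - (q : EuclideanSpace ℝ (Fin 3)))) 0 := by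
  filter_upwards [ha, he] with μ hμ hNash p hp using hasSum_force_of_nash hδ hμ hp (hNash p hp)

/-- **Force balance at the root**, the Palm-side reading: under clauses (a) and (e), for `P`-almost every
configuration `Σ_{q ≠ 0 atoms} (|q|⁻⁸ − |q|⁻¹⁴)·q = 0` (the root `0` is an atom of every rooted hard-core
configuration). [folklore] -/
theorem ae_forceBalance_root_of_nash {δ : ℝ} (hδ : 0 < δ) {P : Measure (Measure (EuclideanSpace ℝ (Fin 3)))}
    (ha : ∀ᵐ μ ∂P, IsRootedHardCore δ μ)
    (he : ∀ᵐ μ ∂P, ∀ p : EuclideanSpace ℝ (Fin 3), μ {p} ≠ 0 → ∀ y : EuclideanSpace ℝ (Fin 3),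
      (∀ q : EuclideanSpace ℝ (Fin 3), μ {q} ≠ 0 → q ≠ p → y ≠ q) →
      ∑' q : {q : EuclideanSpace ℝ (Fin 3) // μ {q} ≠ 0 ∧ q ≠ p},
          lennardJones (dist p (q : EuclideanSpace ℝ (Fin 3))) ≤
        ∑' q : {q : EuclideanSpace ℝ (Fin 3) // μ {q} ≠ 0 ∧ q ≠ p},
          lennardJones (dist y (q : EuclideanSpace ℝ (Fin 3)))) :
    ∀ᵐ μ ∂P, HasSum (fun q : {q : EuclideanSpace ℝ (Fin 3) // μ {q} ≠ 0 ∧ q ≠ 0} =>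
        (‖(q : EuclideanSpace ℝ (Fin 3))‖⁻¹ ^ 8 - ‖(q : EuclideanSpace ℝ (Fin 3))‖⁻¹ ^ 14) •
          (q : EuclideanSpace ℝ (Fin 3))) 0 := by
  filter_upwards [ha, ae_forceBalance_of_nash hδ ha he] with μ hμ hbal
  have h0 : μ {0} ≠ 0 := by rw [hμ.measure_zero_singleton]; exact one_ne_zero
  have h := (hbal 0 h0).neg
  rw [neg_zero] at h
  refine h.congr_fun fun q => ?_
  rw [dist_eq_norm, zero_sub, norm_neg, smul_neg, neg_neg]

end Summit.AtomisticToContinuum.Crystallization.Theorems.FrustratedLawDichotomyNashForceBalance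

end
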